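import Literature.Combinatorics.Sahi2008.MeasureFunctional
import HarnessLib

/-!
# Lieb–Sahi (2022), §1 / Lemma 2.2: the measure-level `E_n` is multilinear; cones and limits

Topic `Literature/Combinatorics/Sahi2008` (sequel of `MeasureFunctional.lean` — the measure-level functional
`msahiE μ n f`, its moment polynomial `momentE n`, `msahiE_eq_momentE`, `continuous_momentE` — and the
measure-level twin of `Multilinear.lean`, which proves the same for the tree's finite-weight `sahiE`).

## Source (read 2026-08-20 from the materialised arXiv text, corpus `paper:arxiv-2107.09838`, pp. 2, 5, 8)

E. H. Lieb, S. Sahi, *On the extension of the FKG inequality to `n` functions*, J. Math. Phys. **63** (2022)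
043301 = arXiv:2107.09838 [LiebSahi2021]:
> §1: "… a sequence of multilinear functionals `E_n(f_1,…,f_n)` … of functions on a probability space".
> Lemma 2.2 (proof): "Any positive `f` can be written as an integral over the characteristic functions of its
> upper level sets … Since `E_3` is multi-linear in `f,g,h`, this reduces Theorem 2.1 to the case of monotone
> characteristic functions."
> Cor. 3.6 (proof): "using the layer-cake principle and multilinearlity as in the proof of Lemma 2.2".
Also [Sahi2008, p. 211]: the `E_n` are "multilinear functionals"; [Blinovsky2013, p. 1].

## What is here (everything PROVED; no named facts; axioms standard)

* `momentE_lin_of_split` — the moment polynomial `momentE n` (Prop. 3.3 at moment level) is LINEAR ALONG EVERY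
  SLOT: if two moment vectors `M₁, M₂` agree with `M` off slot `i` and `M S = a·M₁ S + b·M₂ S` on the sets
  `S ∋ i`, then `P_n(M) = a·P_n(M₁) + b·P_n(M₂)` (induction along the Lieb–Sahi recursion; pure algebra).
* `msahiE_update_lin_of_integrable` — **`E_n` on a measure space is linear in each slot**,
  `E_n(…, a·g + b·h, …) = a·E_n(…, g, …) + b·E_n(…, h, …)`, under integrability of the slot products
  `g·Π_{j∈S∖i} f_j`, `h·Π_{j∈S∖i} f_j`; `msahiE_update_zero` (a zero slot kills `E_n`, unconditionally);
  the bounded-measurable convenience forms `msahiE_update_lin`, `msahiE_update_add`, `msahiE_update_smul`,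
  `msahiE_update_finsetSum` on a finite measure space.
* `msahiE_nonneg_of_cone` — the bookkeeping behind "by multilinearity": if `E_n ≥ 0` on all families drawn from
  a class `𝒢` of bounded measurable functions, then `E_n ≥ 0` on all families of nonnegative finite
  combinations of members of `𝒢`.
* `tendsto_msahiE_of_tendsto` — `E_n` passes to bounded pointwise limits (dominated convergence on the joint
  moments + `continuous_momentE`); `msahiE_nonneg_of_tendsto`.

These are the two tools ("multilinearity", "layer cake / limits") that [LiebSahi2021] invoke for functions on a
probability space; the layer cake itself and Cor. 3.6 are in `LebesgueLevelSets.lean`.  NOTHING here asserts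
Sahi's conjecture.
-/

noncomputable section

namespace Literature.Combinatorics.Sahi2008

open Finset Function MeasureTheory Filter Topology

/-! ### Plumbing on shifted index sets -/

/-- `0` is not a successor. [folklore] -/
private theorem zero_notMem_map_succEmb {n : ℕ} (S : Finset (Fin (n + 1))) :
    (0 : Fin (n + 2)) ∉ S.map (Fin.succEmb (n + 1)) := by
  rw [Finset.mem_map]
  rintro ⟨a, _, ha⟩
  exact Fin.succ_ne_zero a ha

/-- `j+1 ∈ S+1 ↔ j ∈ S`. [folklore] -/
private theorem succ_mem_map_succEmb {n : ℕ} (S : Finset (Fin (n + 1))) (j : Fin (n + 1)) :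
    j.succ ∈ S.map (Fin.succEmb (n + 1)) ↔ j ∈ S := by
  change Fin.succEmb (n + 1) j ∈ S.map (Fin.succEmb (n + 1)) ↔ j ∈ S
  exact Finset.mem_map' _

/-! ### The moment polynomial is linear along every slot -/

/-- **`E_n` is multilinear, at the level of the moment polynomial.**  If the moment vectors `M₁`, `M₂` agree
with `M` on the index sets avoiding slot `i` and `M S = a·M₁ S + b·M₂ S` on those containing `i` (as for the
joint moments of a family whose slot `i` is `a·g + b·h`, resp. `g`, resp. `h`), then
`P_n(M) = a·P_n(M₁) + b·P_n(M₂)`.  Induction along the recursion of Prop. 3.3: the absorbed moment vectors split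
at the corresponding slot of the shorter family. [cite: LiebSahi2021, §1 (multilinear functionals) and Prop. 3.3; Sahi2008, p. 211] -/
theorem momentE_lin_of_split : ∀ (n : ℕ) (i : Fin n) (a b : ℝ) (M M₁ M₂ : Finset (Fin n) → ℝ),
    (∀ S, i ∈ S → M S = a * M₁ S + b * M₂ S) → (∀ S, i ∉ S → M₁ S = M S ∧ M₂ S = M S) →
      momentE n M = a * momentE n M₁ + b * momentE n M₂
  | 0, i, _, _, _, _, _, _, _ => i.elim0
  | 1, i, a, b, M, M₁, M₂, hin, _ => by
    rw [momentE_one, momentE_one, momentE_one]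
    exact hin {0} (by rw [Subsingleton.elim i 0]; exact mem_singleton_self 0)
  | n + 2, i, a, b, M, M₁, M₂, hin, hout => by
    rw [momentE_succ_succ, momentE_succ_succ, momentE_succ_succ]
    revert hin hout
    refine Fin.cases ?_ (fun k => ?_) i
    · -- slot `0`: the head moment splits, the tail moments agree, the absorbed vectors split at their slot
      intro hin hout
      have hT₁ : tailMoments M₁ = tailMoments M :=
        funext fun S => (hout _ (zero_notMem_map_succEmb S)).1
      have hT₂ : tailMoments M₂ = tailMoments M :=
        funext fun S => (hout _ (zero_notMem_map_succEmb S)).2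
      have hU : ∀ k : Fin (n + 1), momentE (n + 1) (updMoments k M) =
          a * momentE (n + 1) (updMoments k M₁) + b * momentE (n + 1) (updMoments k M₂) := by
        intro k
        refine momentE_lin_of_split (n + 1) k a b _ _ _ (fun S hk => ?_) (fun S hk => ?_)
        · simp only [updMoments, if_pos hk]
          exact hin _ (mem_insert_self _ _)
        · simp only [updMoments, if_neg hk]
          exact hout _ (zero_notMem_map_succEmb S)
      have h0 : M {0} = a * M₁ {0} + b * M₂ {0} := hin _ (mem_singleton_self _)
      rw [sum_congr rfl fun k _ => hU k, sum_add_distrib, ← mul_sum, ← mul_sum, hT₁, hT₂, h0]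
      ring
    · -- slot `k+1`: every shorter vector splits at slot `k`, the head moment agrees
      intro hin hout
      have hsucc : ∀ S : Finset (Fin (n + 1)), k.succ ∈ S.map (Fin.succEmb (n + 1)) ↔ k ∈ S :=
        fun S => succ_mem_map_succEmb S k
      have hU : ∀ j : Fin (n + 1), momentE (n + 1) (updMoments j M) =
          a * momentE (n + 1) (updMoments j M₁) + b * momentE (n + 1) (updMoments j M₂) := by
        intro j
        refine momentE_lin_of_split (n + 1) k a b _ _ _ (fun S hk => ?_) (fun S hk => ?_)
        · by_cases hj : j ∈ S
          · simp only [updMoments, if_pos hj]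
            exact hin _ (mem_insert_of_mem ((hsucc S).2 hk))
          · simp only [updMoments, if_neg hj]
            exact hin _ ((hsucc S).2 hk)
        · have h1 : k.succ ∉ S.map (Fin.succEmb (n + 1)) := fun h => hk ((hsucc S).1 h)
          have h2 : k.succ ∉ insert (0 : Fin (n + 2)) (S.map (Fin.succEmb (n + 1))) := by
            rw [mem_insert, not_or]
            exact ⟨Fin.succ_ne_zero k, h1⟩
          by_cases hj : j ∈ S
          · simp only [updMoments, if_pos hj]
            exact hout _ h2
          · simp only [updMoments, if_neg hj]
            exact hout _ h1
      have hT : momentE (n + 1) (tailMoments M) =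
          a * momentE (n + 1) (tailMoments M₁) + b * momentE (n + 1) (tailMoments M₂) := by
        refine momentE_lin_of_split (n + 1) k a b _ _ _ (fun S hk => ?_) (fun S hk => ?_)
        · exact hin _ ((hsucc S).2 hk)
        · exact hout _ fun h => hk ((hsucc S).1 h)
      have hk0 : k.succ ∉ ({0} : Finset (Fin (n + 2))) := by
        rw [mem_singleton]
        exact Fin.succ_ne_zero k
      rw [sum_congr rfl fun j _ => hU j, sum_add_distrib, ← mul_sum, ← mul_sum, hT, (hout _ hk0).1,
        (hout _ hk0).2]
      ring

/-! ### Multilinearity of `E_n` on a measure space -/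

variable {Ω : Type*} [MeasurableSpace Ω]

omit [MeasurableSpace Ω] in
/-- The product over `S ∋ i` of a family updated at slot `i`. [folklore] -/
private theorem prod_update_apply_of_mem {n : ℕ} (f : Fin n → Ω → ℝ) {S : Finset (Fin n)} {i : Fin n}
    (hi : i ∈ S) (φ : Ω → ℝ) (x : Ω) :
    (∏ j ∈ S, update f i φ j) x = φ x * (∏ j ∈ S.erase i, f j) x := by
  rw [prod_update_of_mem hi, sdiff_singleton_eq_erase, Pi.mul_apply]

/-- **`E_n` is linear in each slot, on a measure space**: `E_n(…, a·g + b·h, …) = a·E_n(…, g, …) +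
b·E_n(…, h, …)` whenever the slot products `g·Π_{j∈S∖{i}} f_j` and `h·Π_{j∈S∖{i}} f_j` (`S ∋ i`) are
integrable (so that their integrals are additive).
[cite: LiebSahi2021, §1 (multilinear functionals) and Lemma 2.2 (proof); Sahi2008, p. 211] -/
theorem msahiE_update_lin_of_integrable (μ : Measure Ω) {n : ℕ} (f : Fin n → Ω → ℝ) (i : Fin n)
    (a b : ℝ) (g h : Ω → ℝ)
    (hg : ∀ S : Finset (Fin n), i ∈ S → Integrable (fun x => g x * (∏ j ∈ S.erase i, f j) x) μ)
    (hh : ∀ S : Finset (Fin n), i ∈ S → Integrable (fun x => h x * (∏ j ∈ S.erase i, f j) x) μ) :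
    msahiE μ n (update f i (a • g + b • h)) =
      a * msahiE μ n (update f i g) + b * msahiE μ n (update f i h) := by
  rw [msahiE_eq_momentE, msahiE_eq_momentE, msahiE_eq_momentE]
  refine momentE_lin_of_split n i a b _ _ _ (fun S hi => ?_) (fun S hi => ?_)
  · simp only [prod_update_apply_of_mem f hi]
    have hsplit : (fun x => (a • g + b • h) x * (∏ j ∈ S.erase i, f j) x) = fun x =>
        a * (g x * (∏ j ∈ S.erase i, f j) x) + b * (h x * (∏ j ∈ S.erase i, f j) x) := by
      funext x
      simp only [Pi.add_apply, Pi.smul_apply, smul_eq_mul]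
      ring
    rw [hsplit, integral_add ((hg S hi).const_mul a) ((hh S hi).const_mul b), integral_const_mul,
      integral_const_mul]
  · constructor <;> simp only [prod_update_of_notMem hi]

/-- **A zero slot kills `E_n`** (measure level; no integrability needed). [cite: LiebSahi2021, §1 (multilinear functionals); Sahi2008, p. 211] -/
theorem msahiE_update_zero (μ : Measure Ω) {n : ℕ} (f : Fin n → Ω → ℝ) (i : Fin n) :
    msahiE μ n (update f i 0) = 0 := by
  rw [msahiE_eq_momentE]
  have h := momentE_lin_of_split n i 0 0 (fun S => ∫ x, (∏ j ∈ S, update f i 0 j) x ∂μ)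
    (fun S => ∫ x, (∏ j ∈ S, update f i 0 j) x ∂μ) (fun S => ∫ x, (∏ j ∈ S, update f i 0 j) x ∂μ)
    (fun S hi => ?_) (fun S _ => ⟨rfl, rfl⟩)
  · rw [h]
    ring
  · simp only [prod_update_apply_of_mem f hi, Pi.zero_apply, zero_mul, integral_zero]
    ring

/-- If every entry of the family is identically zero in some slot, `E_n = 0`. [cite: LiebSahi2021, §1 (multilinear functionals)] -/
theorem msahiE_eq_zero_of_slot_zero (μ : Measure Ω) {n : ℕ} (f : Fin n → Ω → ℝ) {i : Fin n}
    (hi : f i = 0) : msahiE μ n f = 0 := by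
  rw [← update_eq_self i f, hi]
  exact msahiE_update_zero μ f i

/-! ### Bounded measurable families on a finite measure space -/

omit [MeasurableSpace Ω] in
/-- `|Π_{j∈S} f_j(x)| ≤ C^{|S|}` for a family bounded by `C`. [folklore] -/
private theorem abs_prod_apply_le {n : ℕ} (f : Fin n → Ω → ℝ) {C : ℝ} (hfC : ∀ j x, |f j x| ≤ C)
    (S : Finset (Fin n)) (x : Ω) : |(∏ j ∈ S, f j) x| ≤ C ^ S.card := by
  rw [Finset.prod_apply, Finset.abs_prod]
  calc ∏ j ∈ S, |f j x| ≤ ∏ _j ∈ S, C :=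
        Finset.prod_le_prod (fun j _ => abs_nonneg _) fun j _ => hfC j x
    _ = C ^ S.card := Finset.prod_const C

/-- A bounded measurable function on a finite measure space is integrable. [folklore] -/
private theorem integrable_of_measurable_of_abs_le (μ : Measure Ω) [IsFiniteMeasure μ] {φ : Ω → ℝ}
    (hm : Measurable φ) {C : ℝ} (hC : ∀ x, |φ x| ≤ C) : Integrable φ μ :=
  (integrable_const C).mono' hm.aestronglyMeasurable (Eventually.of_forall fun x => by
    rw [Real.norm_eq_abs]; exact hC x)

/-- The slot products of a bounded measurable family against a bounded measurable `g` are integrable.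
[folklore] -/
private theorem integrable_mul_prod (μ : Measure Ω) [IsFiniteMeasure μ] {n : ℕ} (f : Fin n → Ω → ℝ)
    (hfm : ∀ j, Measurable (f j)) {C : ℝ} (hfC : ∀ j x, |f j x| ≤ C) {g : Ω → ℝ} (hgm : Measurable g)
    {D : ℝ} (hgD : ∀ x, |g x| ≤ D) (S : Finset (Fin n)) :
    Integrable (fun x => g x * (∏ j ∈ S, f j) x) μ := by
  have hPm : Measurable fun x => (∏ j ∈ S, f j) x := by
    simp only [Finset.prod_apply]
    exact Finset.measurable_prod S fun j _ => hfm j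
  refine integrable_of_measurable_of_abs_le μ (hgm.mul hPm) (C := D * C ^ S.card) fun x => ?_
  rw [abs_mul]
  exact mul_le_mul (hgD x) (abs_prod_apply_le f hfC S x) (abs_nonneg _) ((abs_nonneg _).trans (hgD x))

/-- **`E_n` is linear in each slot** for bounded measurable families on a finite measure space (the other
slots bounded by `C`, the two new entries by `D`). [cite: LiebSahi2021, §1 (multilinear functionals); Sahi2008, p. 211] -/
theorem msahiE_update_lin (μ : Measure Ω) [IsFiniteMeasure μ] {n : ℕ} (f : Fin n → Ω → ℝ)
    (hfm : ∀ j, Measurable (f j)) {C : ℝ} (hfC : ∀ j x, |f j x| ≤ C) (i : Fin n) (a b : ℝ)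
    {g h : Ω → ℝ} (hgm : Measurable g) (hhm : Measurable h) {D : ℝ} (hgD : ∀ x, |g x| ≤ D)
    (hhD : ∀ x, |h x| ≤ D) :
    msahiE μ n (update f i (a • g + b • h)) =
      a * msahiE μ n (update f i g) + b * msahiE μ n (update f i h) :=
  msahiE_update_lin_of_integrable μ f i a b g h
    (fun S _ => integrable_mul_prod μ f hfm hfC hgm hgD (S.erase i))
    (fun S _ => integrable_mul_prod μ f hfm hfC hhm hhD (S.erase i))

/-- Additivity in each slot (bounded measurable families, finite measure). [cite: LiebSahi2021, §1 (multilinear functionals); Blinovsky2013, p. 1] -/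
theorem msahiE_update_add (μ : Measure Ω) [IsFiniteMeasure μ] {n : ℕ} (f : Fin n → Ω → ℝ)
    (hfm : ∀ j, Measurable (f j)) {C : ℝ} (hfC : ∀ j x, |f j x| ≤ C) (i : Fin n) {g h : Ω → ℝ}
    (hgm : Measurable g) (hhm : Measurable h) {D : ℝ} (hgD : ∀ x, |g x| ≤ D) (hhD : ∀ x, |h x| ≤ D) :
    msahiE μ n (update f i (g + h)) = msahiE μ n (update f i g) + msahiE μ n (update f i h) := by
  have key := msahiE_update_lin μ f hfm hfC i 1 1 hgm hhm hgD hhD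
  simp only [one_smul, one_mul] at key
  exact key

/-- Homogeneity in each slot (bounded measurable families, finite measure). [cite: LiebSahi2021, §1 (multilinear functionals); Blinovsky2013, p. 1] -/
theorem msahiE_update_smul (μ : Measure Ω) [IsFiniteMeasure μ] {n : ℕ} (f : Fin n → Ω → ℝ)
    (hfm : ∀ j, Measurable (f j)) {C : ℝ} (hfC : ∀ j x, |f j x| ≤ C) (i : Fin n) (c : ℝ) {g : Ω → ℝ}
    (hgm : Measurable g) {D : ℝ} (hgD : ∀ x, |g x| ≤ D) :
    msahiE μ n (update f i (c • g)) = c * msahiE μ n (update f i g) := by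
  have key := msahiE_update_lin μ f hfm hfC i c 0 hgm hgm hgD hgD
  simp only [zero_smul, add_zero, zero_mul] at key
  exact key

/-- **Linearity over a finite nonnegative-or-not combination in one slot**:
`E_n(…, Σ_{k∈s} c_k g_k, …) = Σ_{k∈s} c_k E_n(…, g_k, …)` for bounded measurable data on a finite measure
space. [cite: LiebSahi2021, §1 (multilinear functionals) and Lemma 2.2 (proof)] -/
theorem msahiE_update_finsetSum (μ : Measure Ω) [IsFiniteMeasure μ] {n : ℕ} (f : Fin n → Ω → ℝ)
    (hfm : ∀ j, Measurable (f j)) {C : ℝ} (hfC : ∀ j x, |f j x| ≤ C) (i : Fin n) {ι : Type*}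
    (s : Finset ι) (c : ι → ℝ) {g : ι → Ω → ℝ} (hgm : ∀ k, Measurable (g k)) {D : ℝ}
    (hgD : ∀ k x, |g k x| ≤ D) :
    msahiE μ n (update f i (fun x => ∑ k ∈ s, c k * g k x)) =
      ∑ k ∈ s, c k * msahiE μ n (update f i (g k)) := by
  classical
  induction s using Finset.induction_on with
  | empty =>
    simp only [Finset.sum_empty]
    exact msahiE_update_zero μ f i
  | insert k s hk ih =>
    -- the partial sum is measurable and bounded by `(Σ_{k∈s} |c_k|)·D`
    have hsm : Measurable fun x => ∑ k ∈ s, c k * g k x :=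
      Finset.measurable_sum s fun k _ => (hgm k).const_mul (c k)
    have hsD : ∀ x, |∑ k ∈ s, c k * g k x| ≤ max D ((∑ k ∈ s, |c k|) * D) := by
      intro x
      refine (Finset.abs_sum_le_sum_abs _ _).trans ((le_max_right _ _).trans' ?_)
      rw [Finset.sum_mul]
      exact Finset.sum_le_sum fun k _ => by
        rw [abs_mul]
        exact mul_le_mul_of_nonneg_left (hgD k x) (abs_nonneg _)
    have hkD : ∀ x, |g k x| ≤ max D ((∑ k ∈ s, |c k|) * D) := fun x => (hgD k x).trans (le_max_left _ _)
    have hfun : (fun x => ∑ k ∈ insert k s, c k * g k x) =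
        c k • g k + (1 : ℝ) • (fun x => ∑ k ∈ s, c k * g k x) := by
      funext x
      simp only [Finset.sum_insert hk, Pi.add_apply, Pi.smul_apply, smul_eq_mul, one_mul]
    rw [hfun, Finset.sum_insert hk, msahiE_update_lin μ f hfm hfC i (c k) 1 (hgm k) hsm hkD hsD, one_mul,
      ih]

/-- **Nonnegativity is preserved by nonnegative combinations in a slot** (the bookkeeping step of "by
multilinearity"). [cite: LiebSahi2021, Lemma 2.2 (proof); Sahi2008, p. 211] -/
theorem msahiE_update_nonneg_of_finsetSum (μ : Measure Ω) [IsFiniteMeasure μ] {n : ℕ}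
    (f : Fin n → Ω → ℝ) (hfm : ∀ j, Measurable (f j)) {C : ℝ} (hfC : ∀ j x, |f j x| ≤ C) (i : Fin n)
    {ι : Type*} (s : Finset ι) {c : ι → ℝ} (hc : ∀ k ∈ s, 0 ≤ c k) {g : ι → Ω → ℝ}
    (hgm : ∀ k, Measurable (g k)) {D : ℝ} (hgD : ∀ k x, |g k x| ≤ D)
    (hpos : ∀ k ∈ s, 0 ≤ msahiE μ n (update f i (g k))) :
    0 ≤ msahiE μ n (update f i (fun x => ∑ k ∈ s, c k * g k x)) := by
  rw [msahiE_update_finsetSum μ f hfm hfC i s c hgm hgD]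
  exact Finset.sum_nonneg fun k hk => mul_nonneg (hc k hk) (hpos k hk)

/-! ### Cones: "by multilinearity" -/

/-- **Nonnegativity of `E_n` passes from a class of generators to nonnegative combinations.**  If `E_n ≥ 0` for
every family drawn from a class `𝒢` of measurable functions bounded by `D`, then `E_n ≥ 0` for every family
whose slots are nonnegative finite combinations `Σ_{k∈s_i} c_{ik} g_{ik}` of members of `𝒢` (slot by slot,
by `msahiE_update_nonneg_of_finsetSum`).  This is the step "since `E_n` is multi-linear … this reduces the
theorem to the case of characteristic functions". [cite: LiebSahi2021, Lemma 2.2 (proof) and Cor. 3.6 (proof); Sahi2008, p. 211] -/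
theorem msahiE_nonneg_of_cone (μ : Measure Ω) [IsFiniteMeasure μ] {n : ℕ} (𝒢 : Set (Ω → ℝ))
    (h𝒢m : ∀ g ∈ 𝒢, Measurable g) {D : ℝ} (hD : 0 ≤ D) (h𝒢D : ∀ g ∈ 𝒢, ∀ x, |g x| ≤ D)
    (hE : ∀ G : Fin n → Ω → ℝ, (∀ i, G i ∈ 𝒢) → 0 ≤ msahiE μ n G)
    {ι : Type*} (s : Fin n → Finset ι) {c : Fin n → ι → ℝ} (hc : ∀ i, ∀ k ∈ s i, 0 ≤ c i k)
    {g : Fin n → ι → Ω → ℝ} (hg : ∀ i k, g i k ∈ 𝒢) :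
    0 ≤ msahiE μ n (fun i x => ∑ k ∈ s i, c i k * g i k x) := by
  classical
  -- the target family and the mixed families (combinations below slot `m`, generators from `m` on)
  set Φ : Fin n → Ω → ℝ := fun i x => ∑ k ∈ s i, c i k * g i k x with hΦ
  -- a common bound for combinations and generators
  set B : ℝ := D + ∑ i, (∑ k ∈ s i, |c i k|) * D with hB
  have hBD : D ≤ B := by
    rw [hB]
    exact le_add_of_nonneg_right (Finset.sum_nonneg fun i _ =>
      mul_nonneg (Finset.sum_nonneg fun k _ => abs_nonneg _) hD)
  have hΦm : ∀ i, Measurable (Φ i) := fun i =>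
    Finset.measurable_sum (s i) fun k _ => (h𝒢m _ (hg i k)).const_mul (c i k)
  have hΦB : ∀ i x, |Φ i x| ≤ B := by
    intro i x
    have h1 : |Φ i x| ≤ (∑ k ∈ s i, |c i k|) * D := by
      refine (Finset.abs_sum_le_sum_abs _ _).trans ?_
      rw [Finset.sum_mul]
      exact Finset.sum_le_sum fun k _ => by
        rw [abs_mul]
        exact mul_le_mul_of_nonneg_left (h𝒢D _ (hg i k) x) (abs_nonneg _)
    refine h1.trans ?_
    rw [hB]
    have h2 : (∑ k ∈ s i, |c i k|) * D ≤ ∑ j, (∑ k ∈ s j, |c j k|) * D :=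
      Finset.single_le_sum (f := fun j => (∑ k ∈ s j, |c j k|) * D)
        (fun j _ => mul_nonneg (Finset.sum_nonneg fun k _ => abs_nonneg _) hD) (Finset.mem_univ i)
    linarith
  have key : ∀ (m : ℕ) (G : Fin n → Ω → ℝ), (∀ i, G i ∈ 𝒢) →
      0 ≤ msahiE μ n (fun i => if i.val < m then Φ i else G i) := by
    intro m
    induction m with
    | zero =>
      intro G hG
      simp only [Nat.not_lt_zero, if_false]
      exact hE G hG
    | succ m ih =>
      intro G hG
      by_cases hm : m < n
      · set i : Fin n := ⟨m, hm⟩ with hi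
        have hmix : (fun j : Fin n => if j.val < m + 1 then Φ j else G j) =
            update (fun j : Fin n => if j.val < m then Φ j else G j) i (Φ i) := by
          funext j
          by_cases hji : j = i
          · subst hji
            rw [update_self, if_pos (Nat.lt_succ_self m)]
          · rw [update_of_ne hji]
            have hjm : j.val ≠ m := fun h => hji (Fin.ext h)
            by_cases hlt : j.val < m
            · rw [if_pos hlt, if_pos (Nat.lt_succ_of_lt hlt)]
            · have : ¬ j.val < m + 1 := by omega
              rw [if_neg hlt, if_neg this]
        rw [hmix]
        -- bounds/measurability of the mixed family
        have hFm : ∀ j, Measurable ((fun j : Fin n => if j.val < m then Φ j else G j) j) := by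
          intro j
          by_cases hlt : j.val < m
          · simp only [hlt, if_true]; exact hΦm j
          · simp only [hlt, if_false]; exact h𝒢m _ (hG j)
        have hFB : ∀ j x, |(fun j : Fin n => if j.val < m then Φ j else G j) j x| ≤ B := by
          intro j x
          by_cases hlt : j.val < m
          · simp only [hlt, if_true]; exact hΦB j x
          · simp only [hlt, if_false]; exact (h𝒢D _ (hG j) x).trans hBD
        refine msahiE_update_nonneg_of_finsetSum μ _ hFm hFB i (s i) (hc i) (fun k => h𝒢m _ (hg i k))
          (fun k x => h𝒢D _ (hg i k) x) fun k _ => ?_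
        -- the updated family is a mixed family at level `m` with a new generator in slot `i`
        have hupd : update (fun j : Fin n => if j.val < m then Φ j else G j) i (g i k) =
            fun j : Fin n => if j.val < m then Φ j else update G i (g i k) j := by
          funext j
          by_cases hji : j = i
          · subst hji
            have : ¬ (i.val < m) := lt_irrefl m
            rw [update_self, if_neg this, update_self]
          · rw [update_of_ne hji, update_of_ne hji]
        rw [hupd]
        refine ih (update G i (g i k)) fun j => ?_
        by_cases hji : j = i
        · subst hji; rw [update_self]; exact hg _ k
        · rw [update_of_ne hji]; exact hG j
      · have hmix : (fun j : Fin n => if j.val < m + 1 then Φ j else G j) =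
            fun j : Fin n => if j.val < m then Φ j else G j := by
          funext j
          have h1 : j.val < m := by omega
          rw [if_pos h1, if_pos (Nat.lt_succ_of_lt h1)]
        rw [hmix]
        exact ih G hG
  -- conclude: at level `n` the mixed family is `Φ`, for any admissible `G`
  by_cases hι : Nonempty ι
  · obtain ⟨k₀⟩ := hι
    have h := key n (fun i => g i k₀) fun i => hg i k₀
    have hmix : (fun i : Fin n => if i.val < n then Φ i else g i k₀) = Φ := by
      funext i
      rw [if_pos i.isLt]
    rwa [hmix] at h
  · -- no generators used: every slot is the empty combination `0`
    have hs : ∀ i, s i = ∅ := fun i =>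
      Finset.eq_empty_of_forall_notMem fun k _ => hι ⟨k⟩
    cases n with
    | zero => rw [msahiE_zero]
    | succ n =>
      refine le_of_eq (msahiE_eq_zero_of_slot_zero μ _ (i := 0) ?_).symm
      funext x
      show ∑ k ∈ s 0, c 0 k * g 0 k x = 0
      rw [hs 0, Finset.sum_empty]

/-! ### Limits: `E_n` is continuous along bounded pointwise convergence -/

/-- **`E_n` passes to bounded pointwise limits**: if measurable families `F_N`, uniformly bounded, converge
pointwise to `f`, then `E_n(F_N) → E_n(f)` (dominated convergence of every joint moment + continuity of the
moment polynomial).  The measure-level form of the limit passages of [LiebSahi2021, Lemma 2.3 / Lemma 3.8].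
[cite: LiebSahi2021, Lemma 2.3 and Lemma 3.8 (limit passages); Def. 3.1] -/
theorem tendsto_msahiE_of_tendsto (μ : Measure Ω) [IsFiniteMeasure μ] {n : ℕ}
    (F : ℕ → Fin n → Ω → ℝ) (f : Fin n → Ω → ℝ) (hFm : ∀ N i, Measurable (F N i)) {C : ℝ}
    (hFC : ∀ N i x, |F N i x| ≤ C) (hlim : ∀ i x, Tendsto (fun N => F N i x) atTop (𝓝 (f i x))) :
    Tendsto (fun N => msahiE μ n (F N)) atTop (𝓝 (msahiE μ n f)) := by
  have hmo : ∀ S : Finset (Fin n),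
      Tendsto (fun N => ∫ x, (∏ i ∈ S, F N i) x ∂μ) atTop (𝓝 (∫ x, (∏ i ∈ S, f i) x ∂μ)) := by
    intro S
    refine tendsto_integral_of_dominated_convergence (fun _ => C ^ S.card) (fun N => ?_)
      (integrable_const _) (fun N => Eventually.of_forall fun x => ?_) (Eventually.of_forall fun x => ?_)
    · have hm : Measurable fun x => (∏ i ∈ S, F N i) x := by
        simp only [Finset.prod_apply]
        exact Finset.measurable_prod S fun i _ => hFm N i
      exact hm.aestronglyMeasurable
    · rw [Real.norm_eq_abs]
      exact abs_prod_apply_le (F N) (hFC N) S x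
    · simp only [Finset.prod_apply]
      exact tendsto_finsetProd S fun i _ => hlim i x
  have hE : (fun N => msahiE μ n (F N)) =
      (momentE n) ∘ (fun N => fun S : Finset (Fin n) => ∫ x, (∏ i ∈ S, F N i) x ∂μ) := by
    funext N
    rw [Function.comp_apply, msahiE_eq_momentE]
  rw [hE, msahiE_eq_momentE]
  exact ((continuous_momentE n).tendsto _).comp (tendsto_pi_nhds.2 hmo)

/-- **Nonnegativity of `E_n` passes to bounded pointwise limits.** [cite: LiebSahi2021, Lemma 2.3 and Lemma 3.8 (limit passages)] -/
theorem msahiE_nonneg_of_tendsto (μ : Measure Ω) [IsFiniteMeasure μ] {n : ℕ}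
    (F : ℕ → Fin n → Ω → ℝ) (f : Fin n → Ω → ℝ) (hFm : ∀ N i, Measurable (F N i)) {C : ℝ}
    (hFC : ∀ N i x, |F N i x| ≤ C) (hlim : ∀ i x, Tendsto (fun N => F N i x) atTop (𝓝 (f i x)))
    (hpos : ∀ N, 0 ≤ msahiE μ n (F N)) : 0 ≤ msahiE μ n f :=
  ge_of_tendsto' (tendsto_msahiE_of_tendsto μ F f hFm hFC hlim) hpos

end Literature.Combinatorics.Sahi2008
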